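import Summits.BirchSwinnertonDyer.BirchSwinnertonDyer.Theorems.EisensteinPrimesResidualDevissageCountNonsplit
import HarnessLib

/-!
# The residual λ-IDENTITY at a NON-SPLIT multiplicative Eisenstein prime, modulo ONE input:
# `p^{λ(X_ac^Σ(E_K))} · #X[p] = #R(S) · #R(E_K[p]/S)` given the residual surjectivity `R(E_K[p]) ↠ R(E_K[p]/S)`
# (cell `bsd-eis`, seat `bsd-line-x2-p2` gen 5, D-0154 KEY row 5; crux 4 `BSDpOnCellC` line b1; sequel of
# `…ResidualDevissageCountNonsplit`)

HONEST FRAMING (cell `bsd-eis`, run/shared/lean/pub/bsd-eis/): bookkeeping on constructed objects; no definition, no named fact,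
no `sorry`, no `Theses` import; nothing about BSD or a main conjecture is asserted; nothing booked; no label or count moves. Helper
`--supports stmt-BirchSwinnertonDyer-19034`; closes no stub. At a NON-SPLIT multiplicative odd Eisenstein prime BOTH error terms of the residual count vanish for the base-changed rational line
`S ≤ E_K[p]`: the LOCAL one because `E_K[p]/S` has no `(ker κ ⊓ D_{v̄})`-fixed vector (file 4 §2,
`exists_stableSubgroup_noFixed_of_not_split`), and the GLOBAL one (Keller–Yin's `+1`) because a vector fixed by all of `ker κ` is in
particular fixed by `ker κ ⊓ D_{v̄}` (`forall_fixed_eq_zero_of_inf`). Hence: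

* `mul_natCard_le_pow_lambdaInvariant_mul_of_surjective_of_noFixed` — for any stable `Φ ≤ E[p]` whose quotient has no
  `(ker κ ⊓ D_𝔭)`-fixed vector: given the residual surjectivity, **`#R(Φ) · #R(E[p]/Φ) ≤ p^{λ(X)} · #X[p]`** (file 4 §1 with the global
  factor `= 1`).
* **`pow_lambdaInvariant_mul_eq_of_not_split_of_surjective`** — at every non-split multiplicative Eisenstein datum (`W/ℚ` globally
  minimal, `2 < p`, `p ‖ N` non-split, `E[p]` reducible; `K` imaginary quadratic, `(p)` split, `v̄ ∋ p`; `κ` anticyclotomic with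
  generator `γ`; `Σ` finite ⊇ the bad places of `E_K` prime to `p`; (L)): there is a stable `S ≤ E_K[p]` (`#S = #(E_K[p]/S) = p`, no fixed
  quotient vector up the tower) such that, IF `R(S)`, `R(E_K[p]/S)` are finite and `R(E_K[p]) ↠ R(E_K[p]/S)`, THEN
  **`p^{λ(X_ac^Σ(E_K))} · #X_ac^Σ(E_K)[p] = #R(S) · #R(E_K[p]/S)`** — Keller–Yin Thm. 1.4.1's first display
  (`λ(𝔛^S_f) = λ(𝔛^S_φ) + λ(𝔛^S_ψ)`, case `ψ|_{G_K} ≠ 1`) in residual currency at `p ‖ N` non-split, with the finite part explicit,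
  CONDITIONAL only on the residual surjectivity (the shadow of [PW11, Prop. A.2] / KY Rem. 1.4.2).
* §3 `exists_stableSubgroup_residualFinite_of_prop14_of_not_split`, **`pow_lambdaInvariant_mul_le_and_eq_of_prop14_of_not_split`** —
  the same at the Keller–Yin Lemma 5.1.1 datum (`Σ = Sf` = places over `N_E` off `p`) with the two residual finiteness inputs
  DISCHARGED from the PUBLISHED named fact `CastellaGrossiLeeSkinner2022.prop14_residualCharacterSelmer_finite` (g4's p626493
  chain, stopped before the dévissage so that the two character groups can be counted): `p^λ · #X[p] ≤ #R(S) · #R(E_K[p]/S)`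
  conditional on prop14 + (L) only; `=` additionally on the residual surjectivity.

References: [KellerYin2024] Thm. 1.4.1, Rem. 1.4.2, §5.1 (arXiv:2402.12781v2); [CastellaGrossiLeeSkinner2022] Thm. 3.2.1, (eq:lambda-imp)
(arXiv:2008.02571 §3); [PollackWeston2011] App. A Prop. A.2; [GreenbergVatsal2000] §2 Prop. (2.8); cell p633662, p634082, p635607.
-/

set_option autoImplicit false
set_option linter.dupNamespace false -- the summit namespace `…BirchSwinnertonDyer.BirchSwinnertonDyer.Theorems` (Sub = Summit, D-0017) trips it

noncomputable section

open scoped Classical Pointwise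

namespace Summit.BirchSwinnertonDyer.BirchSwinnertonDyer.Theorems.ResidualDevissageCountNonsplitIdentity

open WeierstrassCurve NumberField IsDedekindDomain Field
  Literature.NumberTheory.EllipticCurves Literature.NumberTheory.EllipticCurves.IwasawaAlgebra
  Literature.NumberTheory.EllipticCurves.GreenbergSelmer
  Literature.NumberTheory.EllipticCurves.GreenbergVatsal2000
  Literature.NumberTheory.GaloisRepresentations IsDedekindDomain.HeightOneSpectrum
  Literature.NumberTheory.EllipticCurves.Rank1Residual
  Summit.BirchSwinnertonDyer.Rank1Residual.X11b Summit.BirchSwinnertonDyer.Rank1Residual.X11b.AcSelmer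
  Summit.BirchSwinnertonDyer.Rank1Residual.X2.ResidualDevissageModules
  Summit.BirchSwinnertonDyer.BirchSwinnertonDyer.Theorems
  Summit.BirchSwinnertonDyer.BirchSwinnertonDyer.Theorems.ResidualDevissageCountNonsplit
  Summit.BirchSwinnertonDyer.BirchSwinnertonDyer.Theorems.CumulativeHeegnerInclusionAtThreeResidualDevissage
  Summit.BirchSwinnertonDyer.BirchSwinnertonDyer.Theorems.CumulativeHeegnerInclusionAtThreeLineBaseChange
  Summit.BirchSwinnertonDyer.BirchSwinnertonDyer.Theorems.CumulativeHeegnerInclusionAtThreeTowerFixed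
  Summit.BirchSwinnertonDyer.BirchSwinnertonDyer.Theorems.CumulativeHeegnerInclusionAtThreeStubB1LineDeterminant
  Summit.BirchSwinnertonDyer.BirchSwinnertonDyer.Theorems.CumulativeHeegnerInclusionAtThreeBadPlaces
  Summit.BirchSwinnertonDyer.BirchSwinnertonDyer.Theorems.AdditiveKoly.SplitCompletion
  Summit.BirchSwinnertonDyer.BirchSwinnertonDyer.Theorems.KellerYinLemma511NonsplitOfPrint
open Literature.NumberTheory.EllipticCurves.CastellaGrossiLeeSkinner2022 (prop14_residualCharacterSelmer_finite)

/-! ### §1 The global error term vanishes with the local one -/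

/-- A vector fixed by all of `H` is fixed by `H ⊓ D`; so «no non-zero `H ⊓ D`-fixed vector» implies «no non-zero `H`-fixed
vector». [folklore] -/
theorem forall_fixed_eq_zero_of_inf {G : Type*} [Group G] (H D : Subgroup G) {C : Type*} [AddCommGroup C]
    [DistribMulAction G C] (hfix : ∀ c : C, (∀ g : ↥(H ⊓ D), g • c = c) → c = 0) :
    ∀ c : C, (∀ g : ↥H, g • c = c) → c = 0 := fun c hc ↦
  hfix c fun g ↦ hc ⟨g.1, (Subgroup.mem_inf.mp g.2).1⟩

section Curve

variable {K : Type} [Field K] [NumberField K] (W : WeierstrassCurve K) [W.IsElliptic] {p : ℕ}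
  [Fact p.Prime] (κ : ZpExtension K p) (γ : absoluteGaloisGroup K) [Fact (κ.IsTopGenerator γ)]

/-- **`#R(Φ) · #R(E[p]/Φ) ≤ p^{λ(X_ac^Σ(E))} · #X[p]`** given the residual surjectivity, for a stable `Φ ≤ E[p]` whose quotient has no
non-zero `(ker κ ⊓ D_𝔭)`-fixed vector (then it has no `ker κ`-fixed vector either and the global factor of file 4 §1 is `1`).
`p` odd, (L), `Σ` finite ⊇ bad places prime to `p`, `R(E[p])` finite. [cite: KellerYin2024, Thm. 1.4.1 (arXiv:2402.12781v2 §1.4)] -/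
theorem mul_natCard_le_pow_lambdaInvariant_mul_of_surjective_of_noFixed (hp2 : p ≠ 2)
    {𝔭 : HeightOneSpectrum (𝓞 K)} (h𝔭 : ((p : ℕ) : 𝓞 K) ∈ 𝔭.asIdeal)
    {S : Set (HeightOneSpectrum (𝓞 K))} (hSfin : S.Finite)
    (hS : ∀ v : HeightOneSpectrum (𝓞 K), v ∉ S → ((p : ℕ) : 𝓞 K) ∉ v.asIdeal → W.HasGoodReductionAt v)
    (hL : ∀ m : W.geomPrimaryTorsion p, (∀ σ ∈ κ.kerSubgroup ⊓ decomp 𝔭, σ • m = m) → p • m = 0 → m = 0)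
    (Φ : StableSubgroup (absoluteGaloisGroup K) (W.geomTorsion (p : ℤ)))
    (hfix : ∀ y : Φ.Quot, (∀ g : ↥(κ.kerSubgroup ⊓ decomp 𝔭), g • y = y) → y = 0)
    (hE : (datumStrictSelmer κ.kerSubgroup (W.geomTorsion (p : ℤ)) p (AcSelmer.bdpData _ p 𝔭) S :
      Set (Literature.NumberTheory.EllipticCurves.subgroupH1 κ.kerSubgroup (W.geomTorsion (p : ℤ)))).Finite)
    (hsurjR : ∀ z ∈ datumStrictSelmer κ.kerSubgroup Φ.Quot p (AcSelmer.bdpData Φ.Quot p 𝔭) S,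
      ∃ y ∈ datumStrictSelmer κ.kerSubgroup (W.geomTorsion (p : ℤ)) p (AcSelmer.bdpData _ p 𝔭) S,
        resH1Hom (ContinuousMonoidHom.id κ.kerSubgroup) Φ.proj (fun _ b ↦ Φ.proj_smul _ b) y = z) :
    Nat.card (datumStrictSelmer κ.kerSubgroup Φ.Sub p (AcSelmer.bdpData Φ.Sub p 𝔭) S) *
        Nat.card (datumStrictSelmer κ.kerSubgroup Φ.Quot p (AcSelmer.bdpData Φ.Quot p 𝔭) S) ≤
      p ^ lambdaInvariant p (XAc W p κ 𝔭 S γ) * Nat.card {x : XAc W p κ 𝔭 S γ // p • x = 0} := by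
  have h := mul_natCard_le_pow_lambdaInvariant_mul_of_surjective_fixed W κ γ hp2 h𝔭 hSfin hS hL Φ hE hsurjR
  have hK : ∀ y : Φ.Quot, (∀ g : ↥κ.kerSubgroup, g • y = y) → y = 0 :=
    forall_fixed_eq_zero_of_inf κ.kerSubgroup (decomp 𝔭) hfix
  haveI : Subsingleton {y : Φ.Quot // ∀ g : ↥κ.kerSubgroup, g • y = y} :=
    ⟨fun x y ↦ Subtype.ext ((hK x.1 x.2).trans (hK y.1 y.2).symm)⟩
  haveI : Nonempty {y : Φ.Quot // ∀ g : ↥κ.kerSubgroup, g • y = y} := ⟨⟨0, fun g ↦ smul_zero g⟩⟩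
  have h1 : Nat.card {y : Φ.Quot // ∀ g : ↥κ.kerSubgroup, g • y = y} = 1 := Nat.card_unique
  rw [h1, mul_one] at h
  exact h

end Curve

/-! ### §2 The identity at a non-split multiplicative Eisenstein datum -/

section Nonsplit

/-- **`p^{λ(X_ac^Σ(E_K))} · #X_ac^Σ(E_K)[p] = #R(S) · #R(E_K[p]/S)` at a NON-SPLIT multiplicative Eisenstein datum, modulo the residual
surjectivity.** Binders: `W/ℚ` globally minimal, `2 < p`, `p ‖ N` non-split, `E[p]` reducible; `K` imaginary quadratic, `(p)` split,
`v̄ ∋ p`; `κ` anticyclotomic with topological generator `γ`; `Σ` finite containing the bad places of `E_K` prime to `p`; (L)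
`E_K[p^∞]^{G_{K_{∞,v̄}}}` without `p`-torsion. Conclusion: a stable `S ≤ E_K[p]` (the base-changed rational line: `#S = #(E_K[p]/S) = p`,
no `(ker κ ⊓ D_{v̄})`-fixed quotient vector) such that finiteness of `R(S)`, `R(E_K[p]/S)` and the surjectivity `R(E_K[p]) ↠ R(E_K[p]/S)`
give the IDENTITY. («`≤`»: file 4 `pow_lambdaInvariant_le_of_stableSubgroup_fixed` with local factor `1`, representatives from Brink;
«`≥`»: §1; `R(E_K[p])` finite from g4's dévissage + UTD Kummer.) This is the residual form of Keller–Yin Thm. 1.4.1's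
`λ(𝔛^S_f) = λ(𝔛^S_φ) + λ(𝔛^S_ψ)` at `p ‖ N` non-split (`ψ|_{G_K} ≠ 1` automatically), conditional on ONE input.
[cite: KellerYin2024, Thm. 1.4.1, Rem. 1.4.2, §5.1 (arXiv:2402.12781v2)] [cite: CastellaGrossiLeeSkinner2022, Thm. 3.2.1 (arXiv:2008.02571 §3)]
[cite: PollackWeston2011, App. A Prop. A.2] [cite: Brink2007, Cor. 1] -/
theorem pow_lambdaInvariant_mul_eq_of_not_split_of_surjective
    {p : ℕ} [hp : Fact p.Prime] (W : WeierstrassCurve ℚ) [W.IsElliptic] [W.IsGloballyMinimal]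
    (K : Type) [Field K] [NumberField K] (vbar : HeightOneSpectrum (𝓞 K)) (κ : ZpExtension K p)
    (γ : absoluteGaloisGroup K) [Fact (κ.IsTopGenerator γ)]
    (hp2 : 2 < p) (hmult : Mult W p) (hns : ¬ W.HasSplitMultiplicativeReductionAtPrime p)
    (hred : Red W p) (hK : IsImaginaryQuadratic K)
    (hsplit : ((Ideal.span {(p : ℤ)}).primesOver (𝓞 K)).ncard = 2)
    (hvbar : ((p : ℕ) : 𝓞 K) ∈ vbar.asIdeal) (hκ : κ.IsAnticyclotomic)
    {Sg : Set (HeightOneSpectrum (𝓞 K))} (hSgfin : Sg.Finite)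
    (hSg : ∀ w : HeightOneSpectrum (𝓞 K), w ∉ Sg → ((p : ℕ) : 𝓞 K) ∉ w.asIdeal →
      (W.baseChange K).HasGoodReductionAt w)
    (hL : ∀ m : (W.baseChange K).geomPrimaryTorsion p,
      (∀ σ ∈ κ.kerSubgroup ⊓ decomp vbar, σ • m = m) → p • m = 0 → m = 0) :
    ∃ S : StableSubgroup (absoluteGaloisGroup K) ((W.baseChange K).geomTorsion ((p : ℕ) : ℤ)),
      Nat.card S.Sub = p ∧ Nat.card S.Quot = p ∧
        (∀ y : S.Quot, (∀ g : ↥(κ.kerSubgroup ⊓ decomp vbar), g • y = y) → y = 0) ∧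
        ((datumStrictSelmer κ.kerSubgroup S.Sub p (AcSelmer.bdpData S.Sub p vbar) Sg :
            Set (subgroupH1 κ.kerSubgroup S.Sub)).Finite →
          (datumStrictSelmer κ.kerSubgroup S.Quot p (AcSelmer.bdpData S.Quot p vbar) Sg :
            Set (subgroupH1 κ.kerSubgroup S.Quot)).Finite →
          (∀ z ∈ datumStrictSelmer κ.kerSubgroup S.Quot p (AcSelmer.bdpData S.Quot p vbar) Sg,
            ∃ y ∈ datumStrictSelmer κ.kerSubgroup ((W.baseChange K).geomTorsion ((p : ℕ) : ℤ)) p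
              (AcSelmer.bdpData _ p vbar) Sg,
              resH1Hom (ContinuousMonoidHom.id κ.kerSubgroup) S.proj (fun _ b ↦ S.proj_smul _ b) y = z) →
          p ^ lambdaInvariant p (XAc (W.baseChange K) p κ vbar Sg γ) *
              Nat.card {x : XAc (W.baseChange K) p κ vbar Sg γ // p • x = 0} =
            Nat.card (datumStrictSelmer κ.kerSubgroup S.Sub p (AcSelmer.bdpData S.Sub p vbar) Sg) *
              Nat.card (datumStrictSelmer κ.kerSubgroup S.Quot p (AcSelmer.bdpData S.Quot p vbar) Sg)) := by
  have hp2' : p ≠ 2 := by omega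
  haveI hEK : (W.baseChange K).IsElliptic := inferInstanceAs (W.map (algebraMap ℚ K)).IsElliptic
  obtain ⟨S, hSub, hQuot, hfix⟩ := exists_stableSubgroup_noFixed_of_not_split W K vbar κ hp2 hmult hns hred hK
    hsplit hvbar
  have h𝔭dec : ¬ (decomp vbar ≤ κ.kerSubgroup) :=
    ZpExtension.decomp_not_le_kerSubgroup_above_of_isAnticyclotomic_holds K p hK hp2' κ hκ vbar hvbar
  refine ⟨S, hSub, hQuot, hfix, fun hΦ hΨ hsurjR ↦ le_antisymm ?_ ?_⟩
  · -- «≤»: representatives from Brink, local factor `1`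
    obtain ⟨c, hc⟩ := UniversalToricDescentResidualSelmerFinite.forall_resOfLe_conjH1_eq_zero_of_reps (M := S.Sub)
      (κ := κ) vbar h𝔭dec
    have hτex : ∀ i : ℕ, ∃ τ : absoluteGaloisGroup K, κ τ = Multiplicative.ofAdd ((i : ℕ) : ℤ_[p]) :=
      fun i ↦ κ.surjective _
    choose τ hτ using hτex
    have h := pow_lambdaInvariant_le_of_stableSubgroup_fixed (W.baseChange K) κ γ hp2' hvbar h𝔭dec hSgfin hSg hL S c τ
      (hc τ hτ) hΦ hΨ
    haveI : Subsingleton {y : S.Quot // ∀ g : ↥(κ.kerSubgroup ⊓ decomp vbar), g • y = y} :=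
      ⟨fun x y ↦ Subtype.ext ((hfix x.1 x.2).trans (hfix y.1 y.2).symm)⟩
    haveI : Nonempty {y : S.Quot // ∀ g : ↥(κ.kerSubgroup ⊓ decomp vbar), g • y = y} := ⟨⟨0, fun g ↦ smul_zero g⟩⟩
    have h1 : Nat.card {y : S.Quot // ∀ g : ↥(κ.kerSubgroup ⊓ decomp vbar), g • y = y} = 1 := Nat.card_unique
    rw [h1, one_pow, mul_one] at h
    exact h
  · -- «≥»: §1, with `R(E_K[p])` finite from the dévissage + Kummer
    have hfin := ResidualDevissageFiniteKernel.finite_selmerAc_pTorsion_of_line_devissage_of_finite (W.baseChange K) κ hvbar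
      h𝔭dec hSg S hΦ hΨ
    have h2 := UniversalToricDescentResidualSelmerExact.natCard_residualSelmer_eq_natCard_selmerAc_pTorsion (W.baseChange K)
      κ hp2' hvbar hSg hL
    haveI : Finite {s : selmerAc (W.baseChange K) p κ vbar Sg // p • s = 0} := hfin.to_subtype
    haveI : Nonempty {s : selmerAc (W.baseChange K) p κ vbar Sg // p • s = 0} := ⟨⟨0, smul_zero _⟩⟩
    have hE : (datumStrictSelmer κ.kerSubgroup ((W.baseChange K).geomTorsion (p : ℤ)) p (AcSelmer.bdpData _ p vbar) Sg :
        Set (subgroupH1 κ.kerSubgroup ((W.baseChange K).geomTorsion (p : ℤ)))).Finite := by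
      refine Set.finite_coe_iff.mp (Nat.finite_of_card_ne_zero ?_)
      change Nat.card (datumStrictSelmer κ.kerSubgroup ((W.baseChange K).geomTorsion (p : ℤ)) p
        (AcSelmer.bdpData _ p vbar) Sg) ≠ 0
      rw [h2]
      exact (Nat.card_pos (α := {s : selmerAc (W.baseChange K) p κ vbar Sg // p • s = 0})).ne'
    exact mul_natCard_le_pow_lambdaInvariant_mul_of_surjective_of_noFixed (W.baseChange K) κ γ hp2' hvbar hSgfin hSg hL S
      hfix hE hsurjR

end Nonsplit

/-! ### §3 The same with the two residual finiteness inputs DISCHARGED from CGLS22 Prop. 14 (published named fact) -/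

section OfPrint

/-- **At a non-split multiplicative Eisenstein datum, CGLS22 Prop. 14 supplies everything the counts need**: the base-changed rational
line `S ≤ E_K[p]` with `#S = #(E_K[p]/S) = p`, no `(ker κ ⊓ D_{v̄})`-fixed quotient vector, AND `R(S)`, `R(E_K[p]/S)` finite for
`Σ = Sf` (the places of `K` over `N_E` off `p`). This is g4's `residualFinite_of_prop14_of_not_split` (p626493) stopped one step
earlier, so that the two finite groups can be COUNTED rather than only used. CONDITIONAL on the published named fact `hfact`
(Rubin 1991 + Hida 2010 as composed in CGLS22 Prop. 14). [cite: CastellaGrossiLeeSkinner2022, §1.2 Prop. 14, §1.4 Prop. 17 (arXiv:2008.02571)]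
[cite: SilvermanATAEC1994, Ch. V Thm. 5.3, Cor. 5.4] [cite: Brink2007, Cor. 1] -/
theorem exists_stableSubgroup_residualFinite_of_prop14_of_not_split
    (hfact : prop14_residualCharacterSelmer_finite)
    {p : ℕ} [hp : Fact p.Prime] (W : WeierstrassCurve ℚ) [W.IsElliptic] [W.IsGloballyMinimal]
    (K : Type) [Field K] [NumberField K] (vbar : HeightOneSpectrum (𝓞 K))
    (κ : ZpExtension K p) (Sf : Finset (HeightOneSpectrum (𝓞 K)))
    (hp2 : 2 < p) (hmult : Mult W p) (hns : ¬ W.HasSplitMultiplicativeReductionAtPrime p)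
    (hred : Red W p) (hK : IsImaginaryQuadratic K)
    (hH : SatisfiesHeegnerHypothesis (W.conductorNorm ℤ) K)
    (hsplit : ((Ideal.span {(p : ℤ)}).primesOver (𝓞 K)).ncard = 2)
    (hvbar : ((p : ℕ) : 𝓞 K) ∈ vbar.asIdeal) (hκ : κ.IsAnticyclotomic)
    (hSf : ∀ w : HeightOneSpectrum (𝓞 K), w ∈ Sf ↔
      (((W.conductorNorm ℤ : ℤ) : 𝓞 K) ∈ w.asIdeal ∧ ((p : ℕ) : 𝓞 K) ∉ w.asIdeal)) :
    ∃ S : StableSubgroup (absoluteGaloisGroup K) ((W.baseChange K).geomTorsion ((p : ℕ) : ℤ)),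
      Nat.card S.Sub = p ∧ Nat.card S.Quot = p ∧
        (∀ y : S.Quot, (∀ g : ↥(κ.kerSubgroup ⊓ decomp vbar), g • y = y) → y = 0) ∧
        (∀ w : HeightOneSpectrum (𝓞 K), w ∉ (↑Sf : Set (HeightOneSpectrum (𝓞 K))) → ((p : ℕ) : 𝓞 K) ∉ w.asIdeal →
          (W.baseChange K).HasGoodReductionAt w) ∧
        (datumStrictSelmer κ.kerSubgroup S.Sub p (AcSelmer.bdpData S.Sub p vbar) (↑Sf : Set (HeightOneSpectrum (𝓞 K))) :
          Set (subgroupH1 κ.kerSubgroup S.Sub)).Finite ∧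
        (datumStrictSelmer κ.kerSubgroup S.Quot p (AcSelmer.bdpData S.Quot p vbar) (↑Sf : Set (HeightOneSpectrum (𝓞 K))) :
          Set (subgroupH1 κ.kerSubgroup S.Quot)).Finite := by
  have hpp : p.Prime := hp.out
  have hp2' : p ≠ 2 := by omega
  haveI hEK : (W.baseChange K).IsElliptic := inferInstanceAs (W.map (algebraMap ℚ K)).IsElliptic
  haveI : IsGalois ℚ K := isGalois_of_finrank_eq_two K hK.1
  have he : vbar.asIdeal.ramificationIdx (𝓞 ℚ) = 1 :=
    ramificationIdx_eq_one_of_card_primesOver K p hK.1 hsplit vbar hvbar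
  have hf : vbar.asIdeal.inertiaDeg (𝓞 ℚ) = 1 :=
    inertiaDeg_eq_one_of_card_primesOver K p hK.1 hsplit vbar hvbar
  set v : HeightOneSpectrum (𝓞 ℚ) := vbar.under (𝓞 ℚ) with hv
  have hw : vbar.asIdeal.under (𝓞 ℚ) = v.asIdeal := by rw [hv, HeightOneSpectrum.under_asIdeal]
  have hpv : ((p : ℕ) : 𝓞 ℚ) ∈ v.asIdeal := natCast_mem_under K p vbar hvbar
  obtain ⟨Φ, hΦ⟩ := exists_isRationalLine_of_not_irr W p hred
  have hcell : ∀ 𝔓 ∈ v.primesAbove,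
      (¬ ∀ g ∈ 𝔓.decompositionSubgroup (absoluteGaloisGroup ℚ), ∀ P ∈ Φ, g • P = P) ∧
        (¬ ∀ g ∈ 𝔓.decompositionSubgroup (absoluteGaloisGroup ℚ),
          ∀ P : geomTorsion W (p : ℤ), g • P - P ∈ Φ) :=
    fun 𝔓 h𝔓 ↦ KellerYinLemma511NonsplitOfPrint.not_fix_and_not_quot_of_not_split_of_mem_primesAbove W p hp2'
      hmult hns hpv hΦ h𝔓
  obtain ⟨t, ht⟩ := exists_geomTorsion_baseChange_equiv W K ((p : ℕ) : ℤ)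
  have ht' : ∀ (σ : absoluteGaloisGroup K) (P : W.geomTorsion ((p : ℕ) : ℤ)),
      t (absGaloisRestrict ℚ K σ • P) = σ • t P := fun σ P ↦ by
    rw [← resGal_eq_absGaloisRestrict]; exact ht σ P
  obtain ⟨S, hS, hcardS⟩ := exists_stableSubgroup_corr Φ t ht' hΦ.2
  have hSub : Nat.card S.Sub = p := by rw [hcardS, hΦ.1]
  have hEp : Nat.card ((W.baseChange K).geomTorsion ((p : ℕ) : ℤ)) = p ^ 2 :=
    (W.baseChange K).natCard_geomTorsion_prime_eq_sq hpp
  have hQuot : Nat.card S.Quot = p := by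
    have h := S.natCard_eq_mul
    rw [hEp, hSub, sq] at h
    exact (Nat.eq_of_mul_eq_mul_right hpp.pos h).symm
  have hnon1 : ¬ ∀ γ ∈ decomp vbar, ∀ x : S.Sub, γ • x = x :=
    not_forall_decomp_smul_sub_eq_of_corr Φ t ht' S hS
      (not_forall_decomp_smul_eq K Φ hw he hf fun 𝔓 h𝔓 ↦ (hcell 𝔓 h𝔓).1)
  have hnon2 : ¬ ∀ γ ∈ decomp vbar, ∀ y : S.Quot, γ • y = y :=
    not_forall_decomp_smul_quot_eq_of_corr Φ t ht' S hS
      (not_forall_decomp_smul_sub_mem K Φ hw he hf fun 𝔓 h𝔓 ↦ (hcell 𝔓 h𝔓).2)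
  have hfix : ∀ y : S.Quot, (∀ g : ↥(κ.kerSubgroup ⊓ decomp vbar), g • y = y) → y = 0 :=
    eq_zero_of_fixed_of_not_forall_decomp_smul_eq κ vbar hQuot hnon2
  have hωS : ¬ ∀ g ∈ decomp vbar, ∀ m : S.Sub,
      g • m = ((modNCyclotomicCharacter K p g : (ZMod p)ˣ) : ZMod p).val • m :=
    not_forall_smul_sub_eq_cyclotomic (W.baseChange K) p S hSub (decomp vbar) hnon2
  have hωQ : ¬ ∀ g ∈ decomp vbar, ∀ m : S.Quot,
      g • m = ((modNCyclotomicCharacter K p g : (ZMod p)ˣ) : ZMod p).val • m :=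
    not_forall_smul_quot_eq_cyclotomic (W.baseChange K) p S hSub (decomp vbar) hnon1
  set S₀ : Set (HeightOneSpectrum (𝓞 K)) := (↑Sf : Set (HeightOneSpectrum (𝓞 K))) with hS₀
  have hS₀fin : S₀.Finite := Sf.finite_toSet
  have hgood : ∀ w : HeightOneSpectrum (𝓞 K), w ∉ S₀ → ((p : ℕ) : 𝓞 K) ∉ w.asIdeal →
      (W.baseChange K).HasGoodReductionAt w := fun w hw hpw ↦ by
    by_contra hbad
    obtain ⟨ℓ, -, hℓw, hℓN⟩ := exists_prime_mem_dvd_conductorNorm_of_not_hasGoodReductionAt W K w hbad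
    apply hw
    rw [hS₀, Finset.mem_coe, hSf]
    refine ⟨?_, hpw⟩
    obtain ⟨m, hm⟩ := hℓN
    rw [hm, Nat.cast_mul, Int.cast_mul, Int.cast_natCast]
    exact w.asIdeal.mul_mem_right _ hℓw
  have hS₀mem : ∀ w ∈ S₀, ((p : ℕ) : 𝓞 K) ∉ w.asIdeal ∧
      ((w.asIdeal.under ℤ).primesOver (𝓞 K)).ncard = 2 := fun w hw ↦ by
    rw [hS₀, Finset.mem_coe, hSf] at hw
    refine ⟨hw.2, ?_⟩
    obtain ⟨ℓ, hℓ, hℓw⟩ := exists_prime_natCast_mem_asIdeal w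
    haveI : Fact ℓ.Prime := ⟨hℓ⟩
    have hunder : w.asIdeal.under ℤ = Ideal.span {(ℓ : ℤ)} :=
      (liesOver_span_int K ℓ w (by exact_mod_cast hℓw)).over.symm
    have hℓN : ℓ ∣ W.conductorNorm ℤ := by
      have hmem : ((W.conductorNorm ℤ : ℕ) : ℤ) ∈ w.asIdeal.under ℤ := by
        rw [Ideal.under_def, Ideal.mem_comap, map_natCast]
        have := hw.1
        rwa [Int.cast_natCast] at this
      rw [hunder, Ideal.mem_span_singleton] at hmem
      exact_mod_cast hmem
    rw [hunder]
    exact hH ℓ hℓ hℓN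
  have hM : ∀ m : (W.baseChange K).geomTorsion ((p : ℕ) : ℤ),
      Continuous fun g : absoluteGaloisGroup K ↦ g • m :=
    continuous_smul_geomTorsion (W.baseChange K) ((p : ℕ) : ℤ)
  have hunrE : ∀ w : HeightOneSpectrum (𝓞 K), w ∉ S₀ → ((p : ℕ) : 𝓞 K) ∉ w.asIdeal →
      ∀ x ∈ inertia w, ∀ m : (W.baseChange K).geomTorsion ((p : ℕ) : ℤ), x • m = m :=
    fun w hw hpw x hx m ↦ smul_geomTorsion_eq_of_mem_inertia_chosen (W.baseChange K) (hgood w hw hpw) hpw hx m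
  have hunrSub : ∀ w : HeightOneSpectrum (𝓞 K), w ∉ S₀ → ((p : ℕ) : 𝓞 K) ∉ w.asIdeal →
      ∀ x ∈ inertia w, ∀ m : S.Sub, x • m = m := fun w hw hpw x hx m ↦
    S.incl_injective (by rw [StableSubgroup.incl_smul]; exact hunrE w hw hpw x hx _)
  have hunrQuot : ∀ w : HeightOneSpectrum (𝓞 K), w ∉ S₀ → ((p : ℕ) : 𝓞 K) ∉ w.asIdeal →
      ∀ x ∈ inertia w, ∀ m : S.Quot, x • m = m := fun w hw hpw x hx m ↦ by
    obtain ⟨n, rfl⟩ := S.proj_surjective m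
    rw [StableSubgroup.smul_proj, hunrE w hw hpw x hx]
  refine ⟨S, hSub, hQuot, hfix, hgood, ?_, ?_⟩
  · exact hfact K p hK hp2' hsplit κ hκ vbar hvbar S.Sub hSub (S.continuous_smul_sub hM) S₀ hS₀fin
      hS₀mem hunrSub hnon1 hωS
  · exact hfact K p hK hp2' hsplit κ hκ vbar hvbar S.Quot hQuot (S.continuous_smul_quot hM) S₀ hS₀fin
      hS₀mem hunrQuot hnon2 hωQ

/-- **CGLS22 Prop. 14 ⟹ `p^{λ(X^{Sf})} · #X^{Sf}[p] ≤ #R(S) · #R(E_K[p]/S)`, and `=` given the residual surjectivity**, at every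
NON-SPLIT multiplicative Eisenstein datum of Keller–Yin Lemma 5.1.1 (`X^{Sf} = AcSelmer.XAc (E_K) p κ v̄ ↑Sf γ`, `Sf` = the places of
`K` over `N_E` off `p`; (L) at `v̄`). The two residual groups are those of the CHARACTERS of `E[p]^{ss}` over `K_∞`; their orders
are what Rubin's main conjecture prices. CONDITIONAL on the published fact `hfact` (and, for `=`, on the residual surjectivity).
[cite: CastellaGrossiLeeSkinner2022, §1.2 Prop. 14, Thm. 3.2.1 (arXiv:2008.02571)] [cite: KellerYin2024, Thm. 1.4.1, Lemma 5.1.1 (arXiv:2402.12781v2)] -/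
theorem pow_lambdaInvariant_mul_le_and_eq_of_prop14_of_not_split
    (hfact : prop14_residualCharacterSelmer_finite)
    {p : ℕ} [hp : Fact p.Prime] (W : WeierstrassCurve ℚ) [W.IsElliptic] [W.IsGloballyMinimal]
    (K : Type) [Field K] [NumberField K] (vbar : HeightOneSpectrum (𝓞 K))
    (κ : ZpExtension K p) (γ : absoluteGaloisGroup K) [Fact (κ.IsTopGenerator γ)]
    (Sf : Finset (HeightOneSpectrum (𝓞 K)))
    (hp2 : 2 < p) (hmult : Mult W p) (hns : ¬ W.HasSplitMultiplicativeReductionAtPrime p)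
    (hred : Red W p) (hK : IsImaginaryQuadratic K)
    (hH : SatisfiesHeegnerHypothesis (W.conductorNorm ℤ) K)
    (hsplit : ((Ideal.span {(p : ℤ)}).primesOver (𝓞 K)).ncard = 2)
    (hvbar : ((p : ℕ) : 𝓞 K) ∈ vbar.asIdeal) (hκ : κ.IsAnticyclotomic)
    (hSf : ∀ w : HeightOneSpectrum (𝓞 K), w ∈ Sf ↔
      (((W.conductorNorm ℤ : ℤ) : 𝓞 K) ∈ w.asIdeal ∧ ((p : ℕ) : 𝓞 K) ∉ w.asIdeal))
    (hL : ∀ m : (W.baseChange K).geomPrimaryTorsion p,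
      (∀ σ ∈ κ.kerSubgroup ⊓ decomp vbar, σ • m = m) → p • m = 0 → m = 0) :
    ∃ S : StableSubgroup (absoluteGaloisGroup K) ((W.baseChange K).geomTorsion ((p : ℕ) : ℤ)),
      Nat.card S.Sub = p ∧ Nat.card S.Quot = p ∧
        (∀ y : S.Quot, (∀ g : ↥(κ.kerSubgroup ⊓ decomp vbar), g • y = y) → y = 0) ∧
        p ^ lambdaInvariant p (XAc (W.baseChange K) p κ vbar (↑Sf : Set (HeightOneSpectrum (𝓞 K))) γ) *
            Nat.card {x : XAc (W.baseChange K) p κ vbar (↑Sf : Set (HeightOneSpectrum (𝓞 K))) γ // p • x = 0} ≤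
          Nat.card (datumStrictSelmer κ.kerSubgroup S.Sub p (AcSelmer.bdpData S.Sub p vbar)
              (↑Sf : Set (HeightOneSpectrum (𝓞 K)))) *
            Nat.card (datumStrictSelmer κ.kerSubgroup S.Quot p (AcSelmer.bdpData S.Quot p vbar)
              (↑Sf : Set (HeightOneSpectrum (𝓞 K)))) ∧
        ((∀ z ∈ datumStrictSelmer κ.kerSubgroup S.Quot p (AcSelmer.bdpData S.Quot p vbar)
              (↑Sf : Set (HeightOneSpectrum (𝓞 K))),
            ∃ y ∈ datumStrictSelmer κ.kerSubgroup ((W.baseChange K).geomTorsion ((p : ℕ) : ℤ)) p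
              (AcSelmer.bdpData _ p vbar) (↑Sf : Set (HeightOneSpectrum (𝓞 K))),
              resH1Hom (ContinuousMonoidHom.id κ.kerSubgroup) S.proj (fun _ b ↦ S.proj_smul _ b) y = z) →
          p ^ lambdaInvariant p (XAc (W.baseChange K) p κ vbar (↑Sf : Set (HeightOneSpectrum (𝓞 K))) γ) *
              Nat.card {x : XAc (W.baseChange K) p κ vbar (↑Sf : Set (HeightOneSpectrum (𝓞 K))) γ // p • x = 0} =
            Nat.card (datumStrictSelmer κ.kerSubgroup S.Sub p (AcSelmer.bdpData S.Sub p vbar)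
                (↑Sf : Set (HeightOneSpectrum (𝓞 K)))) *
              Nat.card (datumStrictSelmer κ.kerSubgroup S.Quot p (AcSelmer.bdpData S.Quot p vbar)
                (↑Sf : Set (HeightOneSpectrum (𝓞 K))))) := by
  have hp2' : p ≠ 2 := by omega
  haveI hEK : (W.baseChange K).IsElliptic := inferInstanceAs (W.map (algebraMap ℚ K)).IsElliptic
  obtain ⟨S, hSub, hQuot, hfix, hgood, hΦ, hΨ⟩ := exists_stableSubgroup_residualFinite_of_prop14_of_not_split hfact W K vbar
    κ Sf hp2 hmult hns hred hK hH hsplit hvbar hκ hSf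
  have h𝔭dec : ¬ (decomp vbar ≤ κ.kerSubgroup) :=
    ZpExtension.decomp_not_le_kerSubgroup_above_of_isAnticyclotomic_holds K p hK hp2' κ hκ vbar hvbar
  have hSffin : (↑Sf : Set (HeightOneSpectrum (𝓞 K))).Finite := Sf.finite_toSet
  obtain ⟨c, hc⟩ := UniversalToricDescentResidualSelmerFinite.forall_resOfLe_conjH1_eq_zero_of_reps (M := S.Sub)
    (κ := κ) vbar h𝔭dec
  have hτex : ∀ i : ℕ, ∃ τ : absoluteGaloisGroup K, κ τ = Multiplicative.ofAdd ((i : ℕ) : ℤ_[p]) :=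
    fun i ↦ κ.surjective _
  choose τ hτ using hτex
  have hle := pow_lambdaInvariant_le_of_stableSubgroup_fixed (W.baseChange K) κ γ hp2' hvbar h𝔭dec hSffin hgood hL S c τ
    (hc τ hτ) hΦ hΨ
  haveI : Subsingleton {y : S.Quot // ∀ g : ↥(κ.kerSubgroup ⊓ decomp vbar), g • y = y} :=
    ⟨fun x y ↦ Subtype.ext ((hfix x.1 x.2).trans (hfix y.1 y.2).symm)⟩
  haveI : Nonempty {y : S.Quot // ∀ g : ↥(κ.kerSubgroup ⊓ decomp vbar), g • y = y} := ⟨⟨0, fun g ↦ smul_zero g⟩⟩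
  have h1 : Nat.card {y : S.Quot // ∀ g : ↥(κ.kerSubgroup ⊓ decomp vbar), g • y = y} = 1 := Nat.card_unique
  rw [h1, one_pow, mul_one] at hle
  refine ⟨S, hSub, hQuot, hfix, hle, fun hsurjR ↦ le_antisymm hle ?_⟩
  have hfin := ResidualDevissageFiniteKernel.finite_selmerAc_pTorsion_of_line_devissage_of_finite (W.baseChange K) κ hvbar
    h𝔭dec hgood S hΦ hΨ
  have h2 := UniversalToricDescentResidualSelmerExact.natCard_residualSelmer_eq_natCard_selmerAc_pTorsion (W.baseChange K)
    κ hp2' hvbar hgood hL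
  haveI : Finite {s : selmerAc (W.baseChange K) p κ vbar (↑Sf : Set (HeightOneSpectrum (𝓞 K))) // p • s = 0} :=
    hfin.to_subtype
  haveI : Nonempty {s : selmerAc (W.baseChange K) p κ vbar (↑Sf : Set (HeightOneSpectrum (𝓞 K))) // p • s = 0} :=
    ⟨⟨0, smul_zero _⟩⟩
  have hE : (datumStrictSelmer κ.kerSubgroup ((W.baseChange K).geomTorsion (p : ℤ)) p (AcSelmer.bdpData _ p vbar)
      (↑Sf : Set (HeightOneSpectrum (𝓞 K))) :
      Set (subgroupH1 κ.kerSubgroup ((W.baseChange K).geomTorsion (p : ℤ)))).Finite := by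
    refine Set.finite_coe_iff.mp (Nat.finite_of_card_ne_zero ?_)
    change Nat.card (datumStrictSelmer κ.kerSubgroup ((W.baseChange K).geomTorsion (p : ℤ)) p
      (AcSelmer.bdpData _ p vbar) (↑Sf : Set (HeightOneSpectrum (𝓞 K)))) ≠ 0
    rw [h2]
    exact (Nat.card_pos (α := {s : selmerAc (W.baseChange K) p κ vbar (↑Sf : Set (HeightOneSpectrum (𝓞 K))) //
      p • s = 0})).ne'
  exact mul_natCard_le_pow_lambdaInvariant_mul_of_surjective_of_noFixed (W.baseChange K) κ γ hp2' hvbar hSffin hgood hL S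
    hfix hE hsurjR

end OfPrint

end Summit.BirchSwinnertonDyer.BirchSwinnertonDyer.Theorems.ResidualDevissageCountNonsplitIdentity

end
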